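import Summits.ResolutionOfSingularities.ResolutionOfSingularities.Theorems.EquisingularLiftEquisingularLiftNatP1VBSubbundleTransfer
import Summits.ResolutionOfSingularities.ResolutionOfSingularities.Theorems.EquisingularLiftEquisingularLiftNatP1VBHomLift
import Summits.ResolutionOfSingularities.ResolutionOfSingularities.Theorems.EquisingularLiftEquisingularLiftNatP1VBHomTransfer
import Literature.AlgebraicGeometry.KTheory.PullbackVectorBundle
import Literature.AlgebraicGeometry.Modules.VectorBundleFiniteLocallyFree
import HarnessLib

/-!
# [OURS · L1 W4.5(b) · T-P1VB part 13] The packaged lift theorem of rung v8 DIR₀: a sub-line-bundle `L₀ ↪ 𝒞_k` on `ℙ¹_k`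
# with `Ȟ¹(𝓗om(L₀, 𝒞_k/L₀)) = 0` lifts to a sub-line-bundle `𝒪(d) ↪ 𝒞` on `ℙ¹_A`

Cell res-hironaka, LADDER-RESOLUTION rung L (D-0089), slot W4.5(b), crux `Theses.EquisingularLift.EquisingularLiftNat`
(stmt-ResolutionOfSingularities-20038) / child `EquisingularLiftNatThree` (stmt-ResolutionOfSingularities-20148); object **T-P1VB**
(res-L1-w45b-lead-2 BOOK 2026-08-27T09:28:20Z: «(a) downstairs-checkable predicate `H¹(ℙ¹_k, 𝓗om(L₀, N_k/L₀)) = 0`; (b) LIFT THEOREM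
(a) ⇒ ∃ sub-line-bundle `L ⊂ 𝒩` on `ℙ¹_O` with `L|_k = L₀`»), `--supports stmt-ResolutionOfSingularities-20148 --as helper`. NOT a
statement of any manuscript; OURS. AI-written; AI review is weaker than expert review.

WHAT. `exists_frame_monomialGlued` (rank-one frames of `glued_A(a,b)` near every point) and the single packaged statement
**`exists_subLineBundle_lift_projectiveLine`**: `A` Noetherian local with residue field `k` (`A → k` onto), `g : ℙ¹_k → ℙ¹_A`,
`F` a vector bundle on `ℙ¹_A`; on `ℙ¹_k` a line bundle `L₀`, a locally split `ι₀ : L₀ ↪ g^*F` with quotient `Q`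
(`0 → L₀ → g^*F → Q → 0` short exact) and `Ȟ¹((D₊x₀, D₊x₁); 𝓗om(L₀, Q)) = 0`. THEN: `∃ a b (σ : glued_A(a,b) → F)
(e : L₀ ≅ g^*glued_A(a,b))` with `g^*σ = e⁻¹ ≫ ι₀` and `σ` locally split (a sub-line-bundle of `F` restricting to `L₀ ⊆ g^*F`).
It chains part 7 (`exists_iso_pullback_of_lineBundle`: `L₀ ≅ g^*𝒪(d)`), part 9 (`Ȟ¹(𝓗om(L₀,Q)) = 0 ⇒ Ȟ¹(𝓗om(L₀, g^*F)) = 0`, plus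
the tree's invariance of `Ȟ¹(𝓗om(–, N))` under isomorphism), part 11 (the Hom-lift `exists_pullback_map_eq_projectiveLine`) and
part 12 (`isNowhereVanishing_hom_of_retraction`, `isNowhereVanishing_hom_of_pullback`, `exists_retraction_of_isNowhereVanishing_hom`).
No completeness of `A` is used (Nakayama on the twisted two-chart Čech complex, part 10).

References (index only): Hartshorne III §12, III Thm. 5.1, II.5; EGA III 4.
-/

noncomputable section

-- `TopCat.Presheaf`/`Scheme.Modules` are not reducible (as in Mathlib's `AlgebraicGeometry/Modules`).
set_option backward.isDefEq.respectTransparency false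

open CategoryTheory AlgebraicGeometry Limits TopologicalSpace Opposite
open Literature.AlgebraicGeometry.Modules Literature.AlgebraicGeometry.Morphisms Literature.AlgebraicGeometry

attribute [local instance] MvPolynomial.gradedAlgebra Literature.AlgebraicGeometry.Motives.ProjBaseChange.algebraBase

set_option linter.dupNamespace false -- mandated namespace `Summit.<Summit>.<Problem>` of this single-conjunct summit

namespace Summit.ResolutionOfSingularities.ResolutionOfSingularities.Cruxes.EquisingularLiftNat.P1VB

section Package

open Literature.AlgebraicGeometry.Motives.ProjBaseChangeRing (mapGraded irrelevant_le_map isPullback_projMap' isProper_projToSpec)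

variable {A k : Type} [CommRing A] [IsNoetherianRing A] [IsLocalRing A] [Field k] [Algebra A k]

/-- Rank-one frames of the glued line bundle `glued_A(a,b)` near every point of `ℙ¹_A`. [folklore] -/
theorem exists_frame_monomialGlued (A : Type) [CommRing A] (a b : ℕ) (x : ProjCech.PP A 1) :
    ∃ (W : (ProjCech.PP A 1).Opens) (_ : x ∈ W), Nonempty (SheafOfModules.free (Fin 1) ≅ (monomialCocycle A a b).glued.over W) := by
  have hx : x ∈ (⊤ : (ProjCech.PP A 1).Opens) := trivial
  rw [← ProjCech.iSup_cover_eq_top (𝟙 (ProjCech.PP A 1))] at hx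
  obtain ⟨i, hi⟩ := Opens.mem_iSup.mp hx
  exact ⟨_, hi, ⟨(monomialCocycle A a b).frame i⟩⟩

/-- **T-P1VB (rung v8 DIR₀) — THE LIFT OF A SUB-LINE-BUNDLE along the special fibre of `ℙ¹_A`.** `A` Noetherian local with
residue field `k` (`A → k` onto), `g : ℙ¹_k → ℙ¹_A`, `F` a vector bundle on `ℙ¹_A` (e.g. `𝒞`), and on `ℙ¹_k` a line bundle `L₀`
with a locally split embedding `ι₀ : L₀ ↪ g^*F` (a sub-line-bundle, e.g. `K₀ ⊆ 𝒞_k`) and quotient `Q` (`0 → L₀ → g^*F → Q → 0`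
short exact) such that `Ȟ¹((D₊x₀, D₊x₁); 𝓗om(L₀, Q)) = 0` — the downstairs-checkable unobstructedness of DIR₀. Then there are
`a, b`, a morphism `σ : glued_A(a,b) = 𝒪_{ℙ¹_A}(d) → F` and an isomorphism `e : L₀ ≅ g^*glued_A(a,b)` with
**`g^*σ = e⁻¹ ≫ ι₀`** (the lift restricts to the given sub-line-bundle) and **`σ` locally split** (a sub-line-bundle of `F` on
`ℙ¹_A`). Chain: part 7 (`L₀ ≅ g^*𝒪(d)`), part 9 (`Ȟ¹(𝓗om(L₀, Q)) = 0 ⇒ Ȟ¹(𝓗om(L₀, g^*F)) = 0`), part 11 (Hom-lift), part 12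
(sub-bundle transfer). No completeness of `A`. [folklore] -/
theorem exists_subLineBundle_lift_projectiveLine (hπ : Function.Surjective (algebraMap A k))
    (F : (ProjCech.PP A 1).Modules) (hF : Motives.IsVectorBundle F)
    (L₀ Q : (ProjCech.PP k 1).Modules)
    (ι₀ : L₀ ⟶ (Scheme.Modules.pullback (Proj.map (mapGraded A k (Fin 2)) (irrelevant_le_map A k (Fin 2)))).obj F)
    (π : (Scheme.Modules.pullback (Proj.map (mapGraded A k (Fin 2)) (irrelevant_le_map A k (Fin 2)))).obj F ⟶ Q)
    (w : ι₀ ≫ π = 0) (hS : (ShortComplex.mk ι₀ π w).ShortExact)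
    (hL₀ : ∀ x : ProjCech.PP k 1, ∃ (W : (ProjCech.PP k 1).Opens) (_ : x ∈ W),
      Nonempty (SheafOfModules.free (Fin 1) ≅ L₀.over W))
    (hsplit : ∀ x : ProjCech.PP k 1, ∃ (W : (ProjCech.PP k 1).Opens) (_ : x ∈ W)
      (r : ((Scheme.Modules.pullback (Proj.map (mapGraded A k (Fin 2)) (irrelevant_le_map A k (Fin 2)))).obj F).over W ⟶
        L₀.over W), (SheafOfModules.overFunctor _ W).map ι₀ ≫ r = 𝟙 _)
    (hQ : Subsingleton (CechMH1 (ProjCech.toSpec k 1) (sheafHom L₀ Q) (fun i : Fin 2 => ProjCech.Dplus k 1 {i}))) :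
    ∃ (a b : ℕ) (σ : (monomialCocycle A a b).glued ⟶ F)
      (e : L₀ ≅ (Scheme.Modules.pullback (Proj.map (mapGraded A k (Fin 2)) (irrelevant_le_map A k (Fin 2)))).obj
        (monomialCocycle A a b).glued),
      (Scheme.Modules.pullback (Proj.map (mapGraded A k (Fin 2)) (irrelevant_le_map A k (Fin 2)))).map σ = e.inv ≫ ι₀ ∧
      ∀ x : ProjCech.PP A 1, ∃ (W : (ProjCech.PP A 1).Opens) (_ : x ∈ W) (r : F.over W ⟶ (monomialCocycle A a b).glued.over W),
        (SheafOfModules.overFunctor _ W).map σ ≫ r = 𝟙 _ := by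
  haveI : IsProper (ProjCech.toSpec A 1) := isProper_projToSpec (Fin 2) A
  haveI : UniversallyClosed (ProjCech.toSpec A 1) := IsProper.toUniversallyClosed
  have hFfl : Motives.IsFiniteLocallyFree F := isFiniteLocallyFree_of_isVectorBundle hF
  -- (1) part 7: `L₀ ≅ g^* glued_A(a,b)`
  obtain ⟨a, b, ⟨e⟩⟩ := exists_iso_pullback_of_lineBundle k A L₀ hL₀
  -- (2) part 9: `Ȟ¹(𝓗om(L₀, g^*F)) = 0`, transported to `𝓗om(g^*glued, g^*F)`
  have h9 := subsingleton_cechMH1_sheafHom_of_shortExact_projectiveLine k hS hL₀ hQ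
  have h1 := subsingleton_cechMH1_sheafHom_of_iso (ProjCech.toSpec k 1) (fun i : Fin 2 => ProjCech.Dplus k 1 {i}) e _ h9
  -- (3) part 11: the Hom-lift of `e⁻¹ ≫ ι₀`
  obtain ⟨σ, hσ⟩ := exists_pullback_map_eq_projectiveLine hπ a b F hF h1 (e.inv ≫ ι₀)
  refine ⟨a, b, σ, e, hσ, ?_⟩
  -- (4) part 12: `σ` is locally split because `e⁻¹ ≫ ι₀` is (modules typed over `ProjCech.PP k 1` to keep instances cheap)
  let K' : (ProjCech.PP k 1).Modules :=
    (Scheme.Modules.pullback (Proj.map (mapGraded A k (Fin 2)) (irrelevant_le_map A k (Fin 2)))).obj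
      (monomialCocycle A a b).glued
  let F' : (ProjCech.PP k 1).Modules :=
    (Scheme.Modules.pullback (Proj.map (mapGraded A k (Fin 2)) (irrelevant_le_map A k (Fin 2)))).obj F
  have hKfr := exists_frame_monomialGlued A a b
  have hK'fr : ∀ y : ProjCech.PP k 1, ∃ (W : (ProjCech.PP k 1).Opens) (_ : y ∈ W),
      Nonempty (SheafOfModules.free (Fin 1) ≅ K'.over W) := fun y => by
    obtain ⟨W, hy, ⟨κ⟩⟩ := hKfr ((Proj.map (mapGraded A k (Fin 2)) (irrelevant_le_map A k (Fin 2))).base y)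
    exact ⟨Proj.map (mapGraded A k (Fin 2)) (irrelevant_le_map A k (Fin 2)) ⁻¹ᵁ W,
      show y ∈ Proj.map (mapGraded A k (Fin 2)) (irrelevant_le_map A k (Fin 2)) ⁻¹ᵁ W from hy,
      ⟨pullbackFrame (Proj.map (mapGraded A k (Fin 2)) (irrelevant_le_map A k (Fin 2))) κ⟩⟩
  have hsplit' : ∀ y : ProjCech.PP k 1, ∃ (W : (ProjCech.PP k 1).Opens) (_ : y ∈ W) (r : F'.over W ⟶ K'.over W),
      (SheafOfModules.overFunctor (ProjCech.PP k 1).ringCatSheaf W).map (e.inv ≫ ι₀) ≫ r = 𝟙 _ := fun y => by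
    obtain ⟨W, hy, r, hr⟩ := hsplit y
    refine ⟨W, hy, r ≫ (SheafOfModules.overFunctor (ProjCech.PP k 1).ringCatSheaf W).map e.hom, ?_⟩
    have hre : (SheafOfModules.overFunctor (ProjCech.PP k 1).ringCatSheaf W).map (e.inv ≫ ι₀) ≫
        r ≫ (SheafOfModules.overFunctor (ProjCech.PP k 1).ringCatSheaf W).map e.hom =
        (SheafOfModules.overFunctor (ProjCech.PP k 1).ringCatSheaf W).map e.inv ≫
          ((SheafOfModules.overFunctor (ProjCech.PP k 1).ringCatSheaf W).map ι₀ ≫ r) ≫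
            (SheafOfModules.overFunctor (ProjCech.PP k 1).ringCatSheaf W).map e.hom := by
      rw [CategoryTheory.Functor.map_comp]
      simp only [Category.assoc]
    rw [hre, hr, Category.id_comp, ← CategoryTheory.Functor.map_comp, e.inv_hom_id, CategoryTheory.Functor.map_id]
  have hnv' := isNowhereVanishing_hom_of_retraction hK'fr (hFfl.pullback _) _ hsplit'
  rw [← hσ] at hnv'
  have hnv := isNowhereVanishing_hom_of_pullback (algebraMap A k) (ProjCech.toSpec A 1) hπ (isPullback_projMap' A k)
    (isFiniteLocallyFree_monomialGlued A a b) hFfl σ hnv'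
  exact exists_retraction_of_isNowhereVanishing_hom hKfr hFfl σ hnv

end Package

end Summit.ResolutionOfSingularities.ResolutionOfSingularities.Cruxes.EquisingularLiftNat.P1VB

end
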